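import Literature.AlgebraicGeometry.HodgeTheory.QuaternionicQuarticDoublePlaneChartEquiv
import Mathlib.AlgebraicGeometry.Birational.Birational
import HarnessLib

/-!
# The deck chart is birational to the double-plane chart as soon as `h̄` is a non-zero-divisor
# (equivalently: the double-plane chart ring embeds in the deck ring)

Layer `Literature/AlgebraicGeometry/HodgeTheory`. Theorems only (no definition, no named fact). Sequel of
`QuaternionicQuarticDoublePlaneChartEquiv` (`deckRingEquivAway : DeckRing a ≃+* (DoublePlaneRing a)_h̄`,
`isOpenImmersion_spec_map_toDeck`). Written by the prover seat `leafhand-hodge-q8symplecticpowers-4` (g4, cell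
`pub-hsemireg`) for route `HodgeConjecture/Q8SymplecticPowers` (crux K1Q, stmt-HodgeConjecture-24190), brick **Zb-3
«double-plane bridge»** of the S1 programme (`stub_regularVeryGeneralQ`).

The bridge `toDeck : DoublePlaneRing a → DeckRing a ≅ (DoublePlaneRing a)_h̄` is the localisation map, so:

* `toDeck_injective_of_mem_nonZeroDivisors` — it is injective iff (if) `h̄ = [c·σc·α·ψ]` is a non-zero-divisor of the
  double-plane chart ring; then (`isDomain_doublePlaneRing_of_mem_nonZeroDivisors`) the double-plane chart ring is a
  DOMAIN whenever the deck ring is (the tree's `isDomain_deckRing_of_injective`, brick M1-0a″), i.e. the double plane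
  `t² = s·α·ψ` is an integral surface;
* `isDominant_spec_map_toDeck`, **`birationalOver_spec_toDeck`** — for an integral double-plane chart with non-empty deck
  chart, the open immersion `Spec (DeckRing a) ⟶ Spec (DoublePlaneRing a)` is dominant, hence the two charts are
  `Scheme.BirationalOver` the base `Spec R` (Mathlib `Scheme.Hom.birationalOver`); with
  `QuaternionicQuarticDeckChartBirational` every model of `V_(c,ψ)` is then birational to the double plane.

Residue for the consumers (recorded, not proved here): `h̄ ∈ nonZeroDivisors (DoublePlaneRing a)` at the good
parameters — in the plane coordinates of `QuaternionicQuarticDoublePlaneCoordinates` the ring is `K[s, y][t]/(t² − G)`,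
free over `K[s, y]` on `1, t`, and `h̄ ↦ s²y·y·α̃·ψ̃ ∈ K[s, y] ∖ {0}` acts injectively (Zariski's double plane
`z² = f(x, y)` is a free rank-2 algebra over the plane). Honest scope: reductions in explicit commutative algebra;
nothing here bears on HC; S1 ∕ K1Q NOT proved here.

## References

* [Hartshorne1977] R. Hartshorne, Algebraic Geometry (1977), II Prop. 2.3 (b), I Example 1.1.3 (a non-empty open
  subset of an irreducible space is dense).
* [GortzWedhorn2020] U. Görtz, T. Wedhorn, Algebraic Geometry I, 2nd ed. (2020), Prop. 4.32 (2) (birational maps via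
  dense open subschemes).
* [AtiyahMacdonald1969] M. F. Atiyah, I. G. Macdonald, Introduction to Commutative Algebra (1969), Prop. 3.9 and
  Ex. 3.7 (injectivity of `A → S⁻¹A` when `S` has no zero-divisors).
* [Naie2007] D. Naie, The irregularity of cyclic multiple planes after Zariski, Enseign. Math. 53 (2007), §1.2.
-/

noncomputable section

open MvPolynomial CategoryTheory AlgebraicGeometry

namespace Literature.AlgebraicGeometry.HodgeTheory.Q8Family

universe v

section Injective

variable {R : Type v} [CommRing R] {e : ℕ} (a : CIdx e → R)

/-- `DoublePlaneRing a → (DoublePlaneRing a)_h̄` is injective when `h̄` is a non-zero-divisor.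
[cite: AtiyahMacdonald1969, Prop. 3.9 and Ex. 3.7] -/
theorem algebraMap_away_injective_of_mem_nonZeroDivisors
    (h : hBar a ∈ nonZeroDivisors (DoublePlaneRing a)) :
    Function.Injective (algebraMap (DoublePlaneRing a) (Localization.Away (hBar a))) :=
  IsLocalization.injective (M := Submonoid.powers (hBar a)) _ ((Submonoid.powers_le).mpr h)

/-- **The bridge `toDeck` is injective when `h̄` is a non-zero-divisor** (`ofDeck ∘ toDeck` is the localisation map).
[cite: AtiyahMacdonald1969, Prop. 3.9 and Ex. 3.7] [cite: Hartshorne1977, II Prop. 2.3 (b)] -/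
theorem toDeck_injective_of_mem_nonZeroDivisors (h : hBar a ∈ nonZeroDivisors (DoublePlaneRing a)) :
    Function.Injective (toDeck a) := by
  intro x y hxy
  have hc := congrArg (ofDeck a) hxy
  rw [ofDeck_toDeck, ofDeck_toDeck] at hc
  exact algebraMap_away_injective_of_mem_nonZeroDivisors a h hc

/-- Conversely, if `toDeck` is injective then `h̄` is a non-zero-divisor (`toDeck h̄ = h` is a unit of the deck ring).
[cite: AtiyahMacdonald1969, Prop. 3.9 and Ex. 3.7] -/
theorem hBar_mem_nonZeroDivisors_of_toDeck_injective (h : Function.Injective (toDeck a)) :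
    hBar a ∈ nonZeroDivisors (DoublePlaneRing a) := by
  refine mem_nonZeroDivisors_iff_right.mpr fun x hx => h ?_
  rw [map_zero]
  have hx' : toDeck a x * toDeck a (hBar a) = 0 := by rw [← map_mul, hx, map_zero]
  exact (isUnit_toDeck_hBar a).mul_left_eq_zero.mp hx'

/-- **The double-plane chart ring is a domain** when `h̄` is a non-zero-divisor and the deck ring is a domain (it then
embeds into the deck ring). [cite: AtiyahMacdonald1969, Prop. 3.9 and Ex. 3.7] -/
theorem isDomain_doublePlaneRing_of_mem_nonZeroDivisors [IsDomain (DeckRing a)]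
    (h : hBar a ∈ nonZeroDivisors (DoublePlaneRing a)) : IsDomain (DoublePlaneRing a) :=
  (toDeck_injective_of_mem_nonZeroDivisors a h).isDomain (toDeck a).toRingHom

end Injective

/-! ### Birationality of the two charts -/

section Birational

variable {R : Type v} [CommRing R] {e : ℕ} (a : CIdx e → R)

/-- `Spec (toDeck)` lies over `Spec R`. [cite: Hartshorne1977, II Prop. 2.3 (b)] -/
theorem spec_map_toDeck_comp :
    Spec.map (CommRingCat.ofHom (toDeck a).toRingHom) ≫
        Spec.map (CommRingCat.ofHom (algebraMap R (DoublePlaneRing a))) =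
      Spec.map (CommRingCat.ofHom (algebraMap R (DeckRing a))) := by
  rw [← Spec.map_comp, ← CommRingCat.ofHom_comp, AlgHom.toRingHom_eq_coe, AlgHom.comp_algebraMap]

/-- **The deck chart is DENSE in an integral double-plane chart**: for `DoublePlaneRing a` a domain and the deck chart
non-empty, `Spec (DeckRing a) ⟶ Spec (DoublePlaneRing a)` is dominant. [cite: Hartshorne1977, I Example 1.1.3] -/
theorem isDominant_spec_map_toDeck [IsDomain (DoublePlaneRing a)] [Nontrivial (DeckRing a)] :
    IsDominant (Spec.map (CommRingCat.ofHom (toDeck a).toRingHom)) := by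
  haveI := isOpenImmersion_spec_map_toDeck a
  haveI : IrreducibleSpace ↥(Spec (.of (DoublePlaneRing a))) :=
    inferInstanceAs (IrreducibleSpace (PrimeSpectrum (DoublePlaneRing a)))
  haveI : Nonempty ↥(Spec (.of (DeckRing a))) := inferInstanceAs (Nonempty (PrimeSpectrum (DeckRing a)))
  exact ⟨(Spec.map (CommRingCat.ofHom (toDeck a).toRingHom)).isOpenEmbedding.isOpen_range.dense
    (Set.range_nonempty _)⟩

/-- **The deck chart and the double-plane chart are birational over `Spec R`** when the double-plane chart ring is a
domain and the deck chart is non-empty (the dominant open immersion `Spec (DeckRing a) ⟶ Spec (DoublePlaneRing a)`).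
[cite: GortzWedhorn2020, Prop. 4.32 (2)] [cite: Hartshorne1977, I Example 1.1.3] -/
theorem birationalOver_spec_toDeck [IsDomain (DoublePlaneRing a)] [Nontrivial (DeckRing a)] :
    Scheme.BirationalOver (Spec.map (CommRingCat.ofHom (algebraMap R (DeckRing a))))
      (Spec.map (CommRingCat.ofHom (algebraMap R (DoublePlaneRing a)))) := by
  haveI := isOpenImmersion_spec_map_toDeck a
  haveI := isDominant_spec_map_toDeck a
  exact Scheme.Hom.birationalOver (Spec.map (CommRingCat.ofHom (toDeck a).toRingHom)) _ _ (spec_map_toDeck_comp a)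

/-- The same under the non-zero-divisor hypothesis and an integral deck chart. [cite: GortzWedhorn2020, Prop. 4.32 (2)] -/
theorem birationalOver_spec_toDeck_of_mem_nonZeroDivisors [IsDomain (DeckRing a)]
    (h : hBar a ∈ nonZeroDivisors (DoublePlaneRing a)) :
    Scheme.BirationalOver (Spec.map (CommRingCat.ofHom (algebraMap R (DeckRing a))))
      (Spec.map (CommRingCat.ofHom (algebraMap R (DoublePlaneRing a)))) := by
  haveI := isDomain_doublePlaneRing_of_mem_nonZeroDivisors a h
  exact birationalOver_spec_toDeck a

end Birational

end Literature.AlgebraicGeometry.HodgeTheory.Q8Family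

end
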